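import Literature.AlgebraicGeometry.Resolution.AlterationsFibresConnected
import HarnessLib

/-!
# De Jong 1996, 4.12: the finite half of "`Y' → ℙ^{d-1}` is (finite) étale" (proofs)

Topic: `Literature/AlgebraicGeometry/Resolution`. Companion to `AlterationsFibresConnected.lean`
(de Jong 1996, 4.12, p. 68: "Let `X' → Y' → ℙ^{d-1}` be the Stein factorization of `f`. Note
that `Y' → ℙ^{d-1}` is (finite) étale, in view of property (ii) b) of the lemma"), whose named
fact `DeJong1996SteinFactorizationEtale` records both halves of "(finite) étale" in the
situation of 4.12, for the second morphism `π = f.fromNormalization : Y' → ℙ^d_k` of the Stein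
factorisation of `f : X' → ℙ^d_k` (`Y' = f.normalization`, Mathlib's relative normalization,
Stacks 035H).

This file PROVES that the finite half is a formal consequence of the étale half, so that
discharging `DeJong1996SteinFactorizationEtale` amounts to the étaleness of `Y' → ℙ^d_k` alone
(`DeJong1996SteinFactorizationEtale.of_etale`; for the mechanism behind étaleness — normality
of `X'` and (ii) b) — see the docstring of the fact): `π` is integral by construction (Mathlib's
instance `IsIntegralHom f.fromNormalization`), an étale morphism is locally of finite type, and
"a morphism is finite if (and only if) it is integral and of finite type" (Görtz–Wedhorn I,
Examples 12.56 (3); Mathlib `IsFinite.iff_isIntegralHom_and_locallyOfFiniteType`). Consequently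
both morphisms of the Stein factorisation are then proper (`X' → Y'` by cancellation, `π` being
separated).

Deliberately NOT here: Stein factorisation in the Noetherian case (Stacks 03H0 (2): `π` is
finite for every proper `f` over a locally Noetherian base, by the coherence of `f_* 𝒪_{X'}`,
EGA III 3.2.1) — true, but a theory absent from Mathlib and, by the above, not needed for 4.12.
An earlier version of this file took it as a hypothesis (`SteinFactorizationFinite`); that
dependency is removed.

## Sources

* A. J. de Jong, *Smoothness, semi-stability and alterations*, Publ. Math. IHÉS 83 (1996),
  4.12, p. 68. [DeJong1996]
* U. Görtz, T. Wedhorn, *Algebraic Geometry I*, 2nd ed., Examples 12.56 (3) (finite = integral +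
  of finite type), Proposition 12.58 (permanence of properness). [GortzWedhorn2020]
* The Stacks Project, Tag 035H (relative normalization); Tag 03H0 (Stein factorisation,
  Noetherian case). [StacksProject]
-/

noncomputable section

open CategoryTheory CategoryTheory.Limits AlgebraicGeometry TopologicalSpace Topology

namespace Literature.AlgebraicGeometry.Resolution

universe u

open Literature.AlgebraicGeometry.Motives (projectiveSpace)

/-! ## Finite = integral + locally of finite type, for the finite part of a Stein factorisation -/

/-- The second morphism `π : Y' = f.normalization → Y` of the Stein factorisation of a
quasi-compact quasi-separated `f : X → Y` is integral by construction (Stacks 035H), hence it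
is finite as soon as it is locally of finite type: "a morphism is finite if (and only if) it is
integral and of finite type". [cite: GortzWedhorn2020, Examples 12.56 (3)] -/
theorem isFinite_fromNormalization_of_locallyOfFiniteType {X Y : Scheme.{u}} (f : X ⟶ Y)
    [QuasiCompact f] [QuasiSeparated f] [LocallyOfFiniteType f.fromNormalization] :
    IsFinite f.fromNormalization :=
  (IsFinite.iff_isIntegralHom_and_locallyOfFiniteType _).mpr ⟨inferInstance, inferInstance⟩

/-- **The finite half of "(finite) étale" is automatic**: if the second morphism
`π : Y' → Y` of the Stein factorisation of a quasi-compact quasi-separated `f : X → Y` is étale,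
then it is finite — étale morphisms are locally of finite type and `π` is integral
(`isFinite_fromNormalization_of_locallyOfFiniteType`). This is why de Jong writes "(finite)
étale" with the parenthesis (4.12, p. 68). [cite: GortzWedhorn2020, Examples 12.56 (3)] -/
theorem isFinite_fromNormalization_of_etale {X Y : Scheme.{u}} (f : X ⟶ Y)
    [QuasiCompact f] [QuasiSeparated f] [Etale f.fromNormalization] :
    IsFinite f.fromNormalization :=
  isFinite_fromNormalization_of_locallyOfFiniteType f

/-- If `f : X → Y` is proper and the second morphism `π : Y' → Y` of its Stein factorisation is
étale, then both morphisms of the factorisation `f = f' ≫ π` are proper: `π` is finite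
(`isFinite_fromNormalization_of_etale`), hence proper, and `f' = f.toNormalization` is proper
by cancellation, `π` being separated ("f' is proper because f is proper (Proposition 12.58)").
[cite: GortzWedhorn2020, Proposition 12.58] -/
theorem isProper_toNormalization_of_etale {X Y : Scheme.{u}} (f : X ⟶ Y) [IsProper f]
    [Etale f.fromNormalization] : IsProper f.toNormalization := by
  haveI : IsFinite f.fromNormalization := isFinite_fromNormalization_of_etale f
  haveI : IsProper (f.toNormalization ≫ f.fromNormalization) := by
    rw [Scheme.Hom.toNormalization_fromNormalization]
    infer_instance
  exact IsProper.of_comp f.toNormalization f.fromNormalization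

namespace DeJong1996

variable {k : Type u} [Field k] {X : Scheme.{u}} {fX : X ⟶ Spec (.of k)} {Z : Set X} {d : ℕ}
  {X' : Scheme.{u}} {φ : X' ⟶ X} {f : X' ⟶ (projectiveSpace d k).left}

/-- In the situation of 4.12 — a normal projective pair `(X, Z)` of dimension `d + 1` and
`φ : X' → X`, `f : X' → ℙ^d_k` as in Lemma 4.11 — `f` is proper
(`IsLemma411Fibration.isProper`), so if the second morphism `Y' → ℙ^d_k` of the Stein
factorisation `X' → Y' → ℙ^d_k` of `f` is étale then both morphisms of the factorisation are
proper: `Y' → ℙ^d_k` is finite étale and `X' → Y'` is proper (`isProper_toNormalization_of_etale`).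
[cite: DeJong1996, 4.12, p. 68] -/
theorem IsLemma411Fibration.isFinite_and_isProper_of_etale (hP : NormalProjectivePair fX Z)
    (hd : topologicalKrullDim X = (d + 1 : ℕ)) (hF : IsLemma411Fibration fX Z d φ f)
    [QuasiCompact f] [QuasiSeparated f] (het : Etale f.fromNormalization) :
    IsFinite f.fromNormalization ∧ IsProper f.toNormalization := by
  haveI := hF.isProper hP hd
  haveI := het
  exact ⟨isFinite_fromNormalization_of_etale f, isProper_toNormalization_of_etale f⟩

/-- **`DeJong1996SteinFactorizationEtale` reduces to its étale half**: the fact follows from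
the étaleness of `Y' → ℙ^d_k` alone (stated here as an explicit hypothesis with the same
binders as the fact), the finite half being automatic for the integral morphism
`f.fromNormalization` (`isFinite_fromNormalization_of_etale`). [cite: DeJong1996, 4.12, p. 68] -/
theorem _root_.Literature.AlgebraicGeometry.Resolution.DeJong1996SteinFactorizationEtale.of_etale
    (hE : ∀ (k : Type u) [Field k] [IsAlgClosed k] (X : Scheme.{u}) (fX : X ⟶ Spec (.of k))
      (Z : Set X) (d : ℕ) (X' : Scheme.{u}) (φ : X' ⟶ X) (f : X' ⟶ (projectiveSpace d k).left)
      [QuasiCompact f] [QuasiSeparated f],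
      NormalProjectivePair fX Z → topologicalKrullDim X = (d + 1 : ℕ) →
        IsLemma411Fibration fX Z d φ f →
          (∃ y : ↥(projectiveSpace d k).left, Smooth (f.fiberToSpecResidueField y)) →
            Etale f.fromNormalization) :
    DeJong1996SteinFactorizationEtale.{u} :=
  fun k _ _ X fX Z d X' φ f _ _ hP hd hF hy =>
    haveI := hE k X fX Z d X' φ f hP hd hF hy
    ⟨isFinite_fromNormalization_of_etale f, this⟩

end DeJong1996

end Literature.AlgebraicGeometry.Resolution

end
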